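import Summits.MatrixMultiplication.MatrixMultiplication.Theorems.GradedDesignFamily.Negative.SubfieldCellNineRowThreeFifteen
import Summits.MatrixMultiplication.MatrixMultiplication.Theorems.GradedDesignFamily.Negative.SubfieldCellNineWallTwenty
import Summits.MatrixMultiplication.MatrixMultiplication.Theorems.LevelGradedCohnUmansGradedDesignFamilyStubSubfieldCellNineWitnessD
import Summits.MatrixMultiplication.MatrixMultiplication.Theorems.LevelGradedCohnUmansGradedDesignFamilyStubSubfieldCellNineWitnessE
import Summits.MatrixMultiplication.MatrixMultiplication.Theorems.LevelGradedCohnUmansGradedDesignFamilyStubSubfieldCellNineWitnessF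

/-!
# Subfield cell `GL₂(𝔽₉) ⊃ SL₂(𝔽₃)` at level one — the certified ENVELOPE of the `q = 3` cell (one citable statement)

**Honest framing.** VALUE = a kernel-checked summary of ONE finite cell (`|k| = 3`, `|K| = 9`) of ONE
skeleton line (`quadratic_extension_level_one_cell`, stub S3 `stub_subfieldCell`, crux `GradedDesignFamily`,
route `LevelGradedCohnUmans`); NOT summit progress.  The stub is asymptotic; the `q = 3` cell is
exponent-3-empty in any case (`Negative/SubfieldCellNineCubes.lean`).  This file proves NOTHING new in substance:
it PACKAGES the envelope theorems of generations 9–10 and their tightness witnesses into two statements that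
the census / publication seats can cite by one name each, so that no reader has to reassemble seven files.

**The envelope (`subfieldCell_nine_envelope`).**  For every field `k` with `|k| = 3`, field `K'` with
`|K'| = |k|²`, injective hom `φ : SL₂(k) →* GL₂(K')` and non-empty `Y, Z ⊆ GL₂(K')` satisfying the stub's inner
separation clause: `|Y| + |Z| ≤ 20` (`subfieldCell_nine_wall_twenty`, file VI), `2 ≤ |Y| ⇒ |Z| ≤ 17`
(`subfieldCell_nine_rowTwo`, file V) and `3 ≤ |Y| ⇒ |Z| ≤ 15` (`subfieldCell_nine_rowThree15`, file X-b).

**Tightness where known (`subfieldCell_nine_envelope_attained`).**  The clause HOLDS at `|K| = 9` with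
`(|Y|,|Z|) = (1,19)` (`subfieldCell_nine_witnessE`: the wall is attained), `(2,17)` (`subfieldCell_nine_witnessD`:
row two is exact) and `(3,9)` (`subfieldCell_nine_witnessF`), so the only undecided stretch of the envelope for
`|Y| ≤ 3` is `10 ≤ |Z| ≤ 15` on row three (kit-verified Python λ-capacity certificates of generation 8 say `≤ 13`
there; not a Lean theorem).  Rows `|Y| ≥ 4`: `(4,8)` holds (`subfieldCell_nine_witnessC`), `|Z| ≤ 15` by row three.

Cell dossier `SUBFIELD.md` §14–§15 (seat notes of unit b2b-lgcu-subfield, generations 9–10).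
-/

namespace Summit.MatrixMultiplication.MatrixMultiplication.Theorems.GradedDesignFamily.Negative.SubfieldNine

open Matrix

-- theorem names follow the cell's `subfieldCell_nine_*` convention inside the (doubled) summit namespace
set_option linter.dupNamespace false

/-- **The certified envelope of the `q = 3` subfield cell** (every admissible `(k, K', φ)`, every separated
non-empty `(Y, Z)`): `|Y| + |Z| ≤ 20`, `2 ≤ |Y| → |Z| ≤ 17`, `3 ≤ |Y| → |Z| ≤ 15`.  Packaging of files VI, V, X-b;
a finite-cell summary, not summit progress. -/
theorem subfieldCell_nine_envelope {k K' : Type} [Field k] [Fintype k] [DecidableEq k]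
    [Field K'] [Fintype K'] [DecidableEq K'] (hk : Fintype.card k = 3)
    (φ : Matrix.SpecialLinearGroup (Fin 2) k →* Matrix.GeneralLinearGroup (Fin 2) K')
    (hφ : Function.Injective φ) (hK : Fintype.card K' = Fintype.card k ^ 2)
    (Y Z : Finset (Matrix.GeneralLinearGroup (Fin 2) K')) (hY : Y.Nonempty) (hZ : Z.Nonempty)
    (hsep : ∀ z₀ ∈ Z, ∃ cf : (Fin 2 → K') → (Fin 2 → K') → ℂ,
      ∀ a : Matrix.SpecialLinearGroup (Fin 2) k, ∀ y ∈ Y, ∀ y' ∈ Y, ∀ z ∈ Z,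
        (∑ u : Fin 2 → K', cf u (((φ a * y * y'⁻¹ * z : Matrix.GeneralLinearGroup (Fin 2) K') :
            Matrix (Fin 2) (Fin 2) K').mulVec u)) =
          if a = 1 ∧ y = y' ∧ z = z₀ then 1 else 0) :
    Y.card + Z.card ≤ 20 ∧ (2 ≤ Y.card → Z.card ≤ 17) ∧ (3 ≤ Y.card → Z.card ≤ 15) :=
  ⟨subfieldCell_nine_wall_twenty hk φ hφ hK Y Z hY hZ hsep,
   fun h2 => subfieldCell_nine_rowTwo hk φ hφ hK Y Z hsep h2,
   fun h3 => subfieldCell_nine_rowThree15 hk φ hφ hK Y Z hsep h3⟩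

/-- **Tightness of the envelope where it is known**: the inner clause of `stub_subfieldCell` holds at
`|K| = 9` with `(|Y|,|Z|) = (1,19)`, `(2,17)` and `(3,9)` (witnesses E, D, F — exact rational certificates checked by
`native_decide`).  A conjunction of landed theorems; not summit progress. -/
theorem subfieldCell_nine_envelope_attained :
    (∃ (k K : Type) (_ : Field k) (_ : Fintype k) (_ : DecidableEq k)
      (_ : Field K) (_ : Fintype K) (_ : DecidableEq K)
      (φ : Matrix.SpecialLinearGroup (Fin 2) k →* Matrix.GeneralLinearGroup (Fin 2) K),
      Function.Injective φ ∧ Fintype.card K = Fintype.card k ^ 2 ∧ Fintype.card K = 9 ∧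
      ∃ Y Z : Finset (Matrix.GeneralLinearGroup (Fin 2) K),
        Y.card = 1 ∧ Z.card = 19 ∧
        ∀ z₀ ∈ Z, ∃ cf : (Fin 2 → K) → (Fin 2 → K) → ℂ,
          ∀ a : Matrix.SpecialLinearGroup (Fin 2) k, ∀ y ∈ Y, ∀ y' ∈ Y, ∀ z ∈ Z,
            (∑ u : Fin 2 → K, cf u (((φ a * y * y'⁻¹ * z : Matrix.GeneralLinearGroup (Fin 2) K) :
                Matrix (Fin 2) (Fin 2) K).mulVec u)) =
              if a = 1 ∧ y = y' ∧ z = z₀ then 1 else 0) ∧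
    (∃ (k K : Type) (_ : Field k) (_ : Fintype k) (_ : DecidableEq k)
      (_ : Field K) (_ : Fintype K) (_ : DecidableEq K)
      (φ : Matrix.SpecialLinearGroup (Fin 2) k →* Matrix.GeneralLinearGroup (Fin 2) K),
      Function.Injective φ ∧ Fintype.card K = Fintype.card k ^ 2 ∧ Fintype.card K = 9 ∧
      ∃ Y Z : Finset (Matrix.GeneralLinearGroup (Fin 2) K),
        Y.card = 2 ∧ Z.card = 17 ∧
        ∀ z₀ ∈ Z, ∃ cf : (Fin 2 → K) → (Fin 2 → K) → ℂ,
          ∀ a : Matrix.SpecialLinearGroup (Fin 2) k, ∀ y ∈ Y, ∀ y' ∈ Y, ∀ z ∈ Z,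
            (∑ u : Fin 2 → K, cf u (((φ a * y * y'⁻¹ * z : Matrix.GeneralLinearGroup (Fin 2) K) :
                Matrix (Fin 2) (Fin 2) K).mulVec u)) =
              if a = 1 ∧ y = y' ∧ z = z₀ then 1 else 0) ∧
    (∃ (k K : Type) (_ : Field k) (_ : Fintype k) (_ : DecidableEq k)
      (_ : Field K) (_ : Fintype K) (_ : DecidableEq K)
      (φ : Matrix.SpecialLinearGroup (Fin 2) k →* Matrix.GeneralLinearGroup (Fin 2) K),
      Function.Injective φ ∧ Fintype.card K = Fintype.card k ^ 2 ∧ Fintype.card K = 9 ∧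
      ∃ Y Z : Finset (Matrix.GeneralLinearGroup (Fin 2) K),
        Y.card = 3 ∧ Z.card = 9 ∧
        ∀ z₀ ∈ Z, ∃ cf : (Fin 2 → K) → (Fin 2 → K) → ℂ,
          ∀ a : Matrix.SpecialLinearGroup (Fin 2) k, ∀ y ∈ Y, ∀ y' ∈ Y, ∀ z ∈ Z,
            (∑ u : Fin 2 → K, cf u (((φ a * y * y'⁻¹ * z : Matrix.GeneralLinearGroup (Fin 2) K) :
                Matrix (Fin 2) (Fin 2) K).mulVec u)) =
              if a = 1 ∧ y = y' ∧ z = z₀ then 1 else 0) :=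
  ⟨subfieldCell_nine_witnessE, subfieldCell_nine_witnessD, subfieldCell_nine_witnessF⟩

end Summit.MatrixMultiplication.MatrixMultiplication.Theorems.GradedDesignFamily.Negative.SubfieldNine
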